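import Literature.MathematicalPhysics.QuantumFieldTheory.BalabanImbrieJaffe1984to88.BIJ88RestrictedInteraction308
import Mathlib.Analysis.Calculus.IteratedDeriv.Lemmas
import Mathlib.Analysis.SpecialFunctions.ExpDeriv

/-!
# `BalabanImbrieJaffe1984to88.BIJ88RestrictedInteractionAllOrders308` — T. Bałaban, J. Imbrie, A. Jaffe, *Effective action and
cluster properties of the abelian Higgs model*, Commun. Math. Phys. **114** (1988) 257–315 [BalabanImbrieJaffe1988]: Sect. 5.14, p. 308
[PDF 52], verbatim: *"Define z_t(Λ₁₂^{(k)}) for t ∈ [0,1] by replacing Ṽ(Λ₁₂^{(k)}) with tṼ(Λ₁₂^{(k)}), replacing χ(cp(e_k), ·) with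
χ(cp(te_k), ·) … Thus the restrictions and the interactions disappear at t = 0, at which point we have a purely Gaussian expectation.
Thus we define perturbative terms for the action, 𝒫_{k+1} = Σ_{α=1}^{n̄} −(1/α!)(dᵅ/dtᵅ) log z_t|_{t=0}"* (5.14.1)/(5.14.2) — ALL t-DERIVATIVES
of `z(t) = ∫ χ′_{Λ,t}·e^{−tW} dμ`, `χ′_{Λ,t} = Π_{b∈B} χ(c_b·p(te_k), Φ_b)`, both interpolations at once.

statement-level skeleton of published theorems with citation tags; proofs where landed; nothing here is a claim about the Yang–Mills mass gap

ERRATUM (v1.1, docstring only; referee ref-1 gen 27/28, render `lit-balaban-r16/renders/cmp114/original-p052-x2.png`): print's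
(5.14.1) carries a leading MINUS — 𝒫_{k+1}(Λ₁₂^{(k)}) = Σ_{α=1}^{n̄} −(1/α!)(dᵅ/dtᵅ) log z_t(Λ₁₂^{(k)})|_{t=0} — and so does the
remainder (5.14.2), ℛ_k(Λ₁₂^{(k)}) = ∫₀¹ dt −((1−t)^{n̄}/(n̄+1)!)⟨d/dt; …; d/dt⟩_t; the v1 quotation dropped the sign.  Declarations are
unchanged (the minus lives inside `BIJ88Perturbative341.pertPart`).

WHAT THIS FILE ADDS to `BIJ88RestrictedInteraction308` (first order) and `BIJ88RestrictionsAllOrders308` (restrictions alone): for ANY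
finite measure, measurable fields, a measurable interaction `|W| ≤ K` (the hypothesis of `BIJ88Perturbative341`) and EVERY order `n`:
* §1 LEIBNIZ `∂ⁿ_t[χ′_{Λ,t}e^{−tW}] = Σ_i C(n,i)(∂^i_tχ′_{Λ,t})(−W)^{n−i}e^{−tW}` on the branch (`iteratedDeriv_restrictedInteraction`, Mathlib
  `iteratedDeriv_fun_mul`), smooth in `t`, measurable in the fields, and `|∂ⁿ_t F| ≤ (NĈt^{−1} + K)ⁿe^{tK}`
  (`abs_iteratedDeriv_restrictedInteraction_le`, binomial theorem);
* §2 **`z^{(n)}(t₀) = ∫ ∂ⁿ_t[χ′_{Λ,t}e^{−tW}]_{t₀} dμ` for every `n`** on `0 < t₀`, `t₀e_k < e^{−1}` (`iteratedDeriv_integral_restrictedInteraction`: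
  all orders under the integral sign, `hasDerivAt_integral_of_dominated_loc_of_deriv_le` order by order).
The limits `t → 0⁺` (every Taylor coefficient of `z_t` at `0⁺` is a Gaussian moment of `−Ṽ`; `(dᵅ/dtᵅ) log z_t` tends to the cumulants)
are the sequel `BIJ88GaussianMoments308`.

PDF held: `paper:balaban1988-cmp114-bij-abelian-higgs-effective-action` (journal page = PDF page + 256); p. 308 [PDF 52].

CITATION HEADER (lean-in-tree rule).  Part of the lit-balaban TYPED SKELETON (HOME `run/shared/lean/pub/lit-balaban/`), Phase 2,
seat p36 (gen 7, unit `lit-balaban-p36`); row **C2.Eq5.14.1-5.14.2** of `HOME/lit-balaban-r16/ROWS-C2-part2.md` (owner r16; typed leaves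
untouched).  Theorems only; no definitions, no `Prop` facts; axioms standard.
-/

namespace Literature.MathematicalPhysics.QuantumFieldTheory.BalabanImbrieJaffe1984to88.BIJ88RestrictedInteractionAllOrders308

open MeasureTheory ProbabilityTheory Filter Set
open BIJ88Sect2Statements (pLog eK)
open BIJ88Sect5Statements (CutoffProfile cutoff)
open scoped Topology

/-! ## §1 The integrand `F(t) = χ′_{Λ,t}(A)·e^{−tw}`: all t-derivatives (Leibniz) -/

section Integrand

variable (χ : CutoffProfile) {ι Ω : Type*} [MeasurableSpace Ω]

/-- `(d/ds)^m e^{−sw} = (−w)^m e^{−sw}`. [cite: BalabanImbrieJaffe1988, (5.14.2) p.308] -/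
theorem iteratedDeriv_expWeight (w t : ℝ) (m : ℕ) :
    iteratedDeriv m (fun s => Real.exp (-(s * w))) t = (-w) ^ m * Real.exp (-(t * w)) := by
  have h : (fun s : ℝ => Real.exp (-(s * w))) = fun s => Real.exp (-w * s) := by
    funext s; congr 1; ring
  rw [h, iteratedDeriv_exp_const_mul]
  ring_nf

/-- `s ↦ e^{−sw}` is smooth. [cite: BalabanImbrieJaffe1988, (5.14.2) p.308] -/
theorem contDiff_expWeight (w : ℝ) (n : ℕ) : ContDiff ℝ n (fun s : ℝ => Real.exp (-(s * w))) :=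
  Real.contDiff_exp.comp ((contDiff_id.mul contDiff_const).neg)

/-- `s ↦ χ′_{Λ,s}(A)` is `Cⁿ` at every point of the open branch `0 < s`, `se_k < 1`. [cite: BalabanImbrieJaffe1988, (5.14.3) p.309] -/
theorem contDiffAt_prod_cutoff_t (p : ℝ) (B : Finset ι) (A c : ι → ℝ) {ek t : ℝ} (hek : 0 < ek) (ht : 0 < t) (h1 : t * ek < 1)
    (n : ℕ) : ContDiffAt ℝ n (fun s => ∏ b ∈ B, cutoff χ (c b * pLog p (s * ek)) (A b)) t :=
  (contDiffOn_prod fun b _ => BIJ88GaussIntegration309Product.contDiffOn_cutoff_t χ p (A b) (c b) hek n).contDiffAt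
    ((BIJ88ChiTDerivN309.isOpen_branch ek).mem_nhds ⟨ht, h1⟩)

/-- **Leibniz**: `∂ⁿ_t[χ′_{Λ,t}·e^{−tw}] = Σ_{i=0}^{n} C(n,i)·(∂^i_tχ′_{Λ,t})·((−w)^{n−i}e^{−tw})` on the open branch.
[cite: BalabanImbrieJaffe1988, (5.14.3) p.309] -/
theorem iteratedDeriv_restrictedInteraction (p : ℝ) (B : Finset ι) (A c : ι → ℝ) (w : ℝ) {ek t : ℝ} (hek : 0 < ek) (ht : 0 < t)
    (h1 : t * ek < 1) (n : ℕ) :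
    iteratedDeriv n (fun s => (∏ b ∈ B, cutoff χ (c b * pLog p (s * ek)) (A b)) * Real.exp (-(s * w))) t =
      ∑ i ∈ Finset.range (n + 1), (n.choose i : ℝ) *
        iteratedDeriv i (fun s => ∏ b ∈ B, cutoff χ (c b * pLog p (s * ek)) (A b)) t * ((-w) ^ (n - i) * Real.exp (-(t * w))) := by
  rw [iteratedDeriv_fun_mul (contDiffAt_prod_cutoff_t χ p B A c hek ht h1 n) (contDiff_expWeight w n).contDiffAt]
  refine Finset.sum_congr rfl fun i _ => ?_
  rw [iteratedDeriv_expWeight]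

/-- `F` is `C^n` on the open branch, every `n`. [cite: BalabanImbrieJaffe1988, (5.14.3) p.309] -/
theorem contDiffOn_restrictedInteraction (p : ℝ) (B : Finset ι) (A c : ι → ℝ) (w : ℝ) {ek : ℝ} (hek : 0 < ek) (n : ℕ) :
    ContDiffOn ℝ n (fun s => (∏ b ∈ B, cutoff χ (c b * pLog p (s * ek)) (A b)) * Real.exp (-(s * w)))
      {s : ℝ | 0 < s ∧ s * ek < 1} :=
  (contDiffOn_prod fun b _ => BIJ88GaussIntegration309Product.contDiffOn_cutoff_t χ p (A b) (c b) hek n).mul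
    (contDiff_expWeight w n).contDiffOn

/-- On the open branch the n-th t-derivative of `F` has derivative the (n+1)-st. [cite: BalabanImbrieJaffe1988, (5.14.3) p.309] -/
theorem hasDerivAt_iteratedDeriv_restrictedInteraction (p : ℝ) (B : Finset ι) (A c : ι → ℝ) (w : ℝ) {ek t : ℝ} (hek : 0 < ek)
    (ht : 0 < t) (h1 : t * ek < 1) (n : ℕ) :
    HasDerivAt (iteratedDeriv n fun s => (∏ b ∈ B, cutoff χ (c b * pLog p (s * ek)) (A b)) * Real.exp (-(s * w)))
      (iteratedDeriv (n + 1) (fun s => (∏ b ∈ B, cutoff χ (c b * pLog p (s * ek)) (A b)) * Real.exp (-(s * w))) t) t := by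
  set f : ℝ → ℝ := fun s => (∏ b ∈ B, cutoff χ (c b * pLog p (s * ek)) (A b)) * Real.exp (-(s * w)) with hf
  set U : Set ℝ := {s : ℝ | 0 < s ∧ s * ek < 1} with hU
  have hUo : IsOpen U := BIJ88ChiTDerivN309.isOpen_branch ek
  have htU : t ∈ U := ⟨ht, h1⟩
  have hcd : ContDiffOn ℝ ((n + 1 : ℕ) : ℕ∞) f U := contDiffOn_restrictedInteraction χ p B A c w hek (n + 1)
  have hdiffW : DifferentiableOn ℝ (iteratedDerivWithin n f U) U :=
    hcd.differentiableOn_iteratedDerivWithin (by exact_mod_cast Nat.lt_succ_self n) hUo.uniqueDiffOn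
  have hev : iteratedDerivWithin n f U =ᶠ[𝓝 t] iteratedDeriv n f := by
    filter_upwards [hUo.mem_nhds htU] with s hs
    exact iteratedDerivWithin_of_isOpen hUo hs
  have hda : DifferentiableAt ℝ (iteratedDeriv n f) t :=
    ((hdiffW t htU).differentiableAt (hUo.mem_nhds htU)).congr_of_eventuallyEq hev.symm
  rw [iteratedDeriv_succ]
  exact hda.hasDerivAt

/-- `ω ↦ ∂ⁿ_t F(t; Φ(ω), W(ω))` is measurable (Leibniz form + `BIJ88RestrictionsAllOrders308.measurable_iteratedDeriv_prod_cutoff_t`).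
[cite: BalabanImbrieJaffe1988, (5.14.3) p.309] -/
theorem measurable_iteratedDeriv_restrictedInteraction (p : ℝ) (B : Finset ι) {Φ : ι → Ω → ℝ} (hΦ : ∀ b ∈ B, Measurable (Φ b))
    (c : ι → ℝ) {W : Ω → ℝ} (hW : Measurable W) {ek : ℝ} (hek : 0 < ek) (n : ℕ) {t : ℝ} (ht : 0 < t) (h1 : t * ek < 1) :
    Measurable fun ω => iteratedDeriv n
      (fun s => (∏ b ∈ B, cutoff χ (c b * pLog p (s * ek)) (Φ b ω)) * Real.exp (-(s * W ω))) t := by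
  have heq : (fun ω => iteratedDeriv n
      (fun s => (∏ b ∈ B, cutoff χ (c b * pLog p (s * ek)) (Φ b ω)) * Real.exp (-(s * W ω))) t) =
      fun ω => ∑ i ∈ Finset.range (n + 1), (n.choose i : ℝ) *
        iteratedDeriv i (fun s => ∏ b ∈ B, cutoff χ (c b * pLog p (s * ek)) (Φ b ω)) t *
          ((-W ω) ^ (n - i) * Real.exp (-(t * W ω))) := by
    funext ω; exact iteratedDeriv_restrictedInteraction χ p B (fun b => Φ b ω) c (W ω) hek ht h1 n
  rw [heq]
  refine Finset.measurable_sum _ fun i _ => ?_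
  exact ((BIJ88RestrictionsAllOrders308.measurable_iteratedDeriv_prod_cutoff_t χ p B hΦ c hek i ht h1).const_mul _).mul
    ((hW.neg.pow_const _).mul (Real.measurable_exp.comp (hW.const_mul t).neg))

/-- **Pointwise bound, all orders**: with `Ĉ = Ĉ(χ,p,n₀)` of `BIJ88GaussIntegration309Product`, `|w| ≤ K`, on the branch `0 < t`,
`te_k ≤ e^{−1}` and `n ≤ n₀`: `|∂ⁿ_t[χ′_{Λ,t}·e^{−tw}]| ≤ (NĈ·t^{−1} + K)ⁿ·e^{tK}` (Leibniz + binomial theorem).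
[cite: BalabanImbrieJaffe1988, (5.14.4) p.309] -/
theorem abs_iteratedDeriv_restrictedInteraction_le (p : ℝ) (n₀ : ℕ) :
    ∃ C : ℝ, 1 ≤ C ∧ ∀ (B : Finset ι) (A c : ι → ℝ) (w K : ℝ), |w| ≤ K → (∀ b ∈ B, c b ≠ 0) →
      ∀ ⦃ek t : ℝ⦄, 0 < ek → 0 < t → t * ek ≤ Real.exp (-1) → ∀ n, n ≤ n₀ →
        |iteratedDeriv n (fun s => (∏ b ∈ B, cutoff χ (c b * pLog p (s * ek)) (A b)) * Real.exp (-(s * w))) t| ≤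
          ((B.card : ℝ) * C * t⁻¹ + K) ^ n * Real.exp (t * K) := by
  obtain ⟨C, hC1, hC⟩ := BIJ88GaussIntegration309Product.abs_iteratedDeriv_prod_cutoff_t_le (ι := ι) χ p n₀
  refine ⟨C, hC1, ?_⟩
  intro B A c w K hw hc ek t hek ht h1 n hn
  have hlt1 : t * ek < 1 := h1.trans_lt (by rw [← Real.exp_zero]; exact Real.exp_lt_exp.mpr (by norm_num))
  have hK0 : 0 ≤ K := (abs_nonneg w).trans hw
  have hE : Real.exp (-(t * w)) ≤ Real.exp (t * K) := by
    apply Real.exp_le_exp.mpr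
    have : -w ≤ K := (neg_le_abs w).trans hw
    nlinarith
  have hE0 : 0 < Real.exp (-(t * w)) := Real.exp_pos _
  set M : ℝ := (B.card : ℝ) * C * t⁻¹ with hM
  have hM0 : 0 ≤ M := by rw [hM]; exact mul_nonneg (mul_nonneg (Nat.cast_nonneg _) (by linarith)) (inv_nonneg.mpr ht.le)
  rw [iteratedDeriv_restrictedInteraction χ p B A c w hek ht hlt1 n]
  -- term by term
  have hterm : ∀ i ∈ Finset.range (n + 1),
      |(n.choose i : ℝ) * iteratedDeriv i (fun s => ∏ b ∈ B, cutoff χ (c b * pLog p (s * ek)) (A b)) t *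
        ((-w) ^ (n - i) * Real.exp (-(t * w)))| ≤ M ^ i * K ^ (n - i) * (n.choose i : ℝ) * Real.exp (t * K) := by
    intro i hi
    have hin : i ≤ n := Nat.lt_succ_iff.mp (Finset.mem_range.mp hi)
    have hD := hC B A c hc hek ht h1 i (hin.trans hn)
    have hzpow : t ^ (-(i : ℤ)) = t⁻¹ ^ i := by rw [zpow_neg, zpow_natCast, inv_pow]
    rw [hzpow, ← mul_pow] at hD
    have hW : |(-w) ^ (n - i)| ≤ K ^ (n - i) := by
      rw [abs_pow, abs_neg]; exact pow_le_pow_left₀ (abs_nonneg _) hw _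
    rw [abs_mul, abs_mul, abs_mul, Nat.abs_cast, abs_of_pos hE0]
    calc (n.choose i : ℝ) * |iteratedDeriv i (fun s => ∏ b ∈ B, cutoff χ (c b * pLog p (s * ek)) (A b)) t| *
          (|(-w) ^ (n - i)| * Real.exp (-(t * w)))
        ≤ (n.choose i : ℝ) * M ^ i * (K ^ (n - i) * Real.exp (t * K)) := by
          refine mul_le_mul (mul_le_mul_of_nonneg_left hD (Nat.cast_nonneg _)) (mul_le_mul hW hE hE0.le (pow_nonneg hK0 _))
            (mul_nonneg (abs_nonneg _) hE0.le) (mul_nonneg (Nat.cast_nonneg _) (pow_nonneg hM0 _))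
      _ = M ^ i * K ^ (n - i) * (n.choose i : ℝ) * Real.exp (t * K) := by ring
  calc |∑ i ∈ Finset.range (n + 1), (n.choose i : ℝ) *
          iteratedDeriv i (fun s => ∏ b ∈ B, cutoff χ (c b * pLog p (s * ek)) (A b)) t * ((-w) ^ (n - i) * Real.exp (-(t * w)))|
      ≤ ∑ i ∈ Finset.range (n + 1), |(n.choose i : ℝ) *
          iteratedDeriv i (fun s => ∏ b ∈ B, cutoff χ (c b * pLog p (s * ek)) (A b)) t * ((-w) ^ (n - i) * Real.exp (-(t * w)))| :=
        Finset.abs_sum_le_sum_abs _ _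
    _ ≤ ∑ i ∈ Finset.range (n + 1), M ^ i * K ^ (n - i) * (n.choose i : ℝ) * Real.exp (t * K) := Finset.sum_le_sum hterm
    _ = (M + K) ^ n * Real.exp (t * K) := by rw [add_pow, Finset.sum_mul]

end Integrand

/-! ## §2 All orders under the integral sign -/

section UnderIntegral

variable (χ : CutoffProfile) {ι Ω : Type*} [MeasurableSpace Ω]

/-- **All orders under the integral sign** for `z(t) = ∫ χ′_{Λ,t} e^{−tW} dμ`: for ANY finite measure, measurable fields, `c_b ≠ 0`,
measurable `|W| ≤ K`, every `n` and `t₀` on the branch `0 < t₀`, `t₀e_k < e^{−1}`: `t ↦ ∫ ∂ⁿ_t F dμ` has derivative `∫ ∂ⁿ⁺¹_t F|_{t₀} dμ`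
at `t₀` (dominated on `(t₀/2, e^{−1}/e_k)` by `(NĈ(t₀/2)^{−1} + K)^{n+1} e^{TK}`, `T = e^{−1}/e_k`). [cite: BalabanImbrieJaffe1988, (5.14.3) p.309] -/
theorem hasDerivAt_integral_iteratedDeriv_restrictedInteraction (p : ℝ) (μ : Measure Ω) [IsFiniteMeasure μ] (B : Finset ι)
    {Φ : ι → Ω → ℝ} (hΦ : ∀ b ∈ B, Measurable (Φ b)) {c : ι → ℝ} (hc : ∀ b ∈ B, c b ≠ 0) {W : Ω → ℝ} (hW : Measurable W)
    {K : ℝ} (hK : ∀ ω, |W ω| ≤ K) {ek t₀ : ℝ} (hek : 0 < ek) (ht₀ : 0 < t₀) (h1 : t₀ * ek < Real.exp (-1)) (n : ℕ) :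
    Integrable (fun ω => iteratedDeriv (n + 1)
        (fun s => (∏ b ∈ B, cutoff χ (c b * pLog p (s * ek)) (Φ b ω)) * Real.exp (-(s * W ω))) t₀) μ ∧
      HasDerivAt (fun t => ∫ ω, iteratedDeriv n
          (fun s => (∏ b ∈ B, cutoff χ (c b * pLog p (s * ek)) (Φ b ω)) * Real.exp (-(s * W ω))) t ∂μ)
        (∫ ω, iteratedDeriv (n + 1)
          (fun s => (∏ b ∈ B, cutoff χ (c b * pLog p (s * ek)) (Φ b ω)) * Real.exp (-(s * W ω))) t₀ ∂μ) t₀ := by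
  classical
  set T : ℝ := Real.exp (-1) / ek with hT
  set s : Set ℝ := Set.Ioo (t₀ / 2) T with hs
  have ht₀T : t₀ < T := by rwa [hT, lt_div_iff₀ hek]
  have ht₀s : t₀ ∈ s := ⟨by linarith, ht₀T⟩
  have hsn : s ∈ 𝓝 t₀ := isOpen_Ioo.mem_nhds ht₀s
  have hs_pos : ∀ x ∈ s, 0 < x := fun x hx => by linarith [hx.1]
  have hs_le : ∀ x ∈ s, x * ek ≤ Real.exp (-1) := fun x hx => by
    have := hx.2; rw [hT, lt_div_iff₀ hek] at this; exact this.le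
  have hlt1 : ∀ x : ℝ, x * ek ≤ Real.exp (-1) → x * ek < 1 := fun x hx =>
    hx.trans_lt (by rw [← Real.exp_zero]; exact Real.exp_lt_exp.mpr (by norm_num))
  obtain ⟨C, hC1, hC⟩ := abs_iteratedDeriv_restrictedInteraction_le (ι := ι) χ p (n + 1)
  set Kb : ℝ := ((B.card : ℝ) * C * (t₀ / 2)⁻¹ + K) ^ (n + 1) * Real.exp (T * K) with hKb
  set F : ℝ → Ω → ℝ := fun x ω => iteratedDeriv n
    (fun s => (∏ b ∈ B, cutoff χ (c b * pLog p (s * ek)) (Φ b ω)) * Real.exp (-(s * W ω))) x with hF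
  set F' : ℝ → Ω → ℝ := fun x ω => iteratedDeriv (n + 1)
    (fun s => (∏ b ∈ B, cutoff χ (c b * pLog p (s * ek)) (Φ b ω)) * Real.exp (-(s * W ω))) x with hF'
  refine hasDerivAt_integral_of_dominated_loc_of_deriv_le (F := F) (F' := F') (bound := fun _ => Kb) hsn ?_ ?_ ?_ ?_ ?_ ?_
  · exact Filter.eventually_of_mem hsn fun x hx =>
      (measurable_iteratedDeriv_restrictedInteraction χ p B hΦ c hW hek n (hs_pos x hx) (hlt1 x (hs_le x hx))).aestronglyMeasurable
  · refine (integrable_const ((((B.card : ℝ) * C * t₀⁻¹ + K) ^ n) * Real.exp (t₀ * K))).mono'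
      (measurable_iteratedDeriv_restrictedInteraction χ p B hΦ c hW hek n ht₀ (hlt1 t₀ h1.le)).aestronglyMeasurable ?_
    refine Filter.Eventually.of_forall fun ω => ?_
    rw [Real.norm_eq_abs, hF]
    exact hC B (fun b => Φ b ω) c (W ω) K (hK ω) hc hek ht₀ h1.le n (Nat.le_succ n)
  · exact (measurable_iteratedDeriv_restrictedInteraction χ p B hΦ c hW hek (n + 1) ht₀ (hlt1 t₀ h1.le)).aestronglyMeasurable
  · refine Filter.Eventually.of_forall fun ω x hx => ?_
    have hx0 : 0 < x := hs_pos x hx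
    have hK0 : 0 ≤ K := (abs_nonneg _).trans (hK ω)
    have h := hC B (fun b => Φ b ω) c (W ω) K (hK ω) hc hek hx0 (hs_le x hx) (n + 1) le_rfl
    rw [Real.norm_eq_abs, hF']
    refine h.trans ?_
    rw [hKb]
    have hNC : 0 ≤ (B.card : ℝ) * C := mul_nonneg (Nat.cast_nonneg _) (by linarith)
    have hxinv : x⁻¹ ≤ (t₀ / 2)⁻¹ := by rw [inv_le_inv₀ hx0 (by linarith)]; exact hx.1.le
    have hbase : (B.card : ℝ) * C * x⁻¹ + K ≤ (B.card : ℝ) * C * (t₀ / 2)⁻¹ + K := by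
      have := mul_le_mul_of_nonneg_left hxinv hNC; linarith
    have hbase0 : 0 ≤ (B.card : ℝ) * C * x⁻¹ + K := add_nonneg (mul_nonneg hNC (inv_nonneg.mpr hx0.le)) hK0
    refine mul_le_mul (pow_le_pow_left₀ hbase0 hbase _) (Real.exp_le_exp.mpr ?_) (Real.exp_pos _).le
      (pow_nonneg (hbase0.trans hbase) _)
    exact mul_le_mul_of_nonneg_right hx.2.le hK0
  · exact integrable_const Kb
  · exact Filter.Eventually.of_forall fun ω x hx =>
      hasDerivAt_iteratedDeriv_restrictedInteraction χ p B (fun b => Φ b ω) c (W ω) hek (hs_pos x hx) (hlt1 x (hs_le x hx)) n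

/-- **`z^{(n)}(t₀) = ∫ ∂ⁿ_t[χ′_{Λ,t} e^{−tW}]_{t₀} dμ` for every `n`** on the branch. [cite: BalabanImbrieJaffe1988, (5.14.3) p.309] -/
theorem iteratedDeriv_integral_restrictedInteraction (p : ℝ) (μ : Measure Ω) [IsFiniteMeasure μ] (B : Finset ι)
    {Φ : ι → Ω → ℝ} (hΦ : ∀ b ∈ B, Measurable (Φ b)) {c : ι → ℝ} (hc : ∀ b ∈ B, c b ≠ 0) {W : Ω → ℝ} (hW : Measurable W)
    {K : ℝ} (hK : ∀ ω, |W ω| ≤ K) {ek : ℝ} (hek : 0 < ek) (n : ℕ) {t₀ : ℝ} (ht₀ : 0 < t₀) (h1 : t₀ * ek < Real.exp (-1)) :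
    iteratedDeriv n (fun t => ∫ ω, (∏ b ∈ B, cutoff χ (c b * pLog p (t * ek)) (Φ b ω)) * Real.exp (-(t * W ω)) ∂μ) t₀ =
      ∫ ω, iteratedDeriv n (fun s => (∏ b ∈ B, cutoff χ (c b * pLog p (s * ek)) (Φ b ω)) * Real.exp (-(s * W ω))) t₀ ∂μ := by
  induction n generalizing t₀ with
  | zero => simp only [iteratedDeriv_zero]
  | succ n ih =>
    rw [iteratedDeriv_succ]
    have hev : iteratedDeriv n (fun t => ∫ ω, (∏ b ∈ B, cutoff χ (c b * pLog p (t * ek)) (Φ b ω)) * Real.exp (-(t * W ω)) ∂μ)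
        =ᶠ[𝓝 t₀] fun t => ∫ ω, iteratedDeriv n
          (fun s => (∏ b ∈ B, cutoff χ (c b * pLog p (s * ek)) (Φ b ω)) * Real.exp (-(s * W ω))) t ∂μ := by
      have hmem : Set.Ioo 0 (Real.exp (-1) / ek) ∈ 𝓝 t₀ := isOpen_Ioo.mem_nhds ⟨ht₀, by rwa [lt_div_iff₀ hek]⟩
      filter_upwards [hmem] with t ht
      exact ih ht.1 (by rw [← lt_div_iff₀ hek]; exact ht.2)
    rw [hev.deriv_eq]
    exact (hasDerivAt_integral_iteratedDeriv_restrictedInteraction χ p μ B hΦ hc hW hK hek ht₀ h1 n).2.deriv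

end UnderIntegral


end Literature.MathematicalPhysics.QuantumFieldTheory.BalabanImbrieJaffe1984to88.BIJ88RestrictedInteractionAllOrders308
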